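import Summits.ResolutionOfSingularities.ResolutionOfSingularities.Theorems.FrobeniusLadderFRationalResolutionEtaleChartTwoStepModel
import HarnessLib

/-!
# Crux `FrobeniusLadder.FRationalResolution` (stmt-ResolutionOfSingularities-15317), line `redirect`,
# stub `stub_diagonalizableQuotientResolution` — THE NO-GALOIS NAIVE TWO-STEP PIPELINE, SCHEME FORM: `hloc` / `HasResolution` from an
# ÉTALE NEIGHBOURHOOD `(Y, y) → (X, x)` and a MODEL `T` with `(T_𝔳)^ ≅ (𝒪_{Y,y})^`

Scheme form of `…EtaleChartTwoStepModel.hloc_of_model_charts_etale` (ring-data extraction as in `…EtaleChartTwoStep` /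
`…EtaleChartStalkBlowupPow`: affine `U ∋ x` isolating the singular point, affine `V ∋ y` over `U`, `Γ(X,U) → Γ(Y,V)` étale, `y ↔ 𝔔`,
`𝒪_{Y,y} ≅ Γ(Y,V)_𝔔`, hence `(𝒪_{Y,y})^ ≅ (Γ(Y,V)_𝔔)^` by `…CompletedBaseChangeFibreCompletion.exists_ringEquiv_adicCompletion_of_ringEquiv`).

* ★★★ `hloc_of_model_charts_etale_nhd` — `X` integral, locally of finite type over a field, `Sing X` finite, `φ : Y → X` étale,
  `x = φ y` singular; a model `T` of finite type over a field `κ`, `𝔳` maximal, `Spec T` regular at the primes `⊊ 𝔳`,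
  `e : (T_𝔳)^ ≃+* (𝒪_{Y,y})^`, generators `x_i` of `𝔳^{a+1}` and the chart facts on `T[𝔳^{a+1}/x_i]` ⇒ `hloc` at `x`;
* ★★★ `hasResolution_of_model_charts_etale_nhd` — if every singular point has such data, `X` has a resolution.

Honest label: assembly toward ONE leaf stub (no stub, crux or summit closed). No definitions, no named facts, no sorry.
[cite: Kollar2007, §2.2] [cite: Matsumura1987, Thm. 8.4; Thm. 8.14; Thm. 23.7] [cite: StacksProject, Tag 0804; Tag 080B]
-/

noncomputable section

-- single-problem summit: the doubled namespace component is forced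
set_option linter.dupNamespace false

open CategoryTheory AlgebraicGeometry TopologicalSpace IsLocalRing
open scoped TensorProduct
open Literature.AlgebraicGeometry.Resolution

namespace Summit.ResolutionOfSingularities.ResolutionOfSingularities.Theorems.FRationalResolution.EtaleChartTwoStepModelScheme

/-- ★★★ **`hloc` FROM AN ÉTALE NEIGHBOURHOOD AND A MODEL OF ITS COMPLETE LOCAL RING.** See the module docstring.
[cite: Kollar2007, §2.2] [cite: Matsumura1987, Thm. 8.4; Thm. 8.14; Thm. 23.7] [cite: StacksProject, Tag 0804; Tag 080B] -/
theorem hloc_of_model_charts_etale_nhd (k : Type) [Field k] (X : Scheme.{0}) [IsIntegral X]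
    (f : X ⟶ Spec (.of k)) [LocallyOfFiniteType f] (hfin : (Scheme.regularLocus X)ᶜ.Finite)
    {Y : Scheme.{0}} (φ : Y ⟶ X) [Etale φ] (y : Y) (hx : φ y ∉ Scheme.regularLocus X) (a : ℕ)
    (κ : Type) [Field κ] (T : Type) [CommRing T] [Algebra κ T] [Algebra.FiniteType κ T] (𝔳 : Ideal T) [𝔳.IsMaximal]
    (hoff : ∀ t : Spec (.of T), t.asIdeal ≤ 𝔳 → t.asIdeal ≠ 𝔳 → t ∈ Scheme.regularLocus (Spec (.of T)))
    (e : (AdicCompletion (maximalIdeal (Localization.AtPrime 𝔳)) (Localization.AtPrime 𝔳)) ≃+* AdicCompletion (maximalIdeal (Y.presheaf.stalk y)) (Y.presheaf.stalk y))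
    {n : ℕ} (x : Fin n → T) (hxv : 𝔳 ^ (a + 1) = Ideal.span (Set.range x))
    (hfinm : ∀ i : Fin n, {𝔫 : PrimeSpectrum (blowupAlgebra (𝔳 ^ (a + 1)) (x i)) |
      𝔳.map (algebraMap T (blowupAlgebra (𝔳 ^ (a + 1)) (x i))) ≤ 𝔫.asIdeal ∧
        ¬ IsRegularLocalRing (Localization.AtPrime 𝔫.asIdeal)}.Finite)
    (hmodel : ∀ (i : Fin n) (𝔫 : PrimeSpectrum (blowupAlgebra (𝔳 ^ (a + 1)) (x i))),
      𝔳.map (algebraMap T (blowupAlgebra (𝔳 ^ (a + 1)) (x i))) ≤ 𝔫.asIdeal →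
      ¬ IsRegularLocalRing (Localization.AtPrime 𝔫.asIdeal) →
      Scheme.IsRegular (affineBlowup (R := Localization.AtPrime 𝔫.asIdeal)
        (maximalIdeal (Localization.AtPrime 𝔫.asIdeal)))) :
    ∃ (W : X.Opens), φ y ∈ W ∧ (∀ t : X, t ∉ Scheme.regularLocus X → t ∈ W → t = φ y) ∧
      ∃ (Z : Scheme.{0}) (ρ : Z ⟶ W), IsProper ρ ∧ Scheme.IsRegular Z ∧
        IsIso (ρ ∣_ (W.ι ⁻¹ᵁ ⟨Scheme.regularLocus X, isOpen_regularLocus_of_locallyOfFiniteType_field f⟩)) ∧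
        Dense ((ρ ⁻¹ᵁ (W.ι ⁻¹ᵁ ⟨Scheme.regularLocus X,
          isOpen_regularLocus_of_locallyOfFiniteType_field f⟩) : Z.Opens) : Set Z) := by
  classical
  set x₀ := φ y with hxdef
  -- (1) the other singular points form a finite set of closed points; remove them
  set S : Set X := (Scheme.regularLocus X)ᶜ \ {x₀} with hS
  have hSfin : S.Finite := hfin.subset Set.sdiff_subset
  have hSclosed : IsClosed S := by
    have : S = ⋃ z ∈ S, {z} := (Set.biUnion_of_singleton S).symm
    rw [this]
    exact hSfin.isClosed_biUnion fun z hz =>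
      IsolatedClosed.isClosed_singleton_of_finite_singularLocus k X f hfin hz.1
  let W₀ : X.Opens := ⟨Sᶜ, hSclosed.isOpen_compl⟩
  have hxW₀ : x₀ ∈ W₀ := fun h => h.2 rfl
  -- (2) an affine open `U ∋ x₀` inside `W₀`
  obtain ⟨U, hU, hxU, hUW⟩ := exists_isAffineOpen_mem_and_subset (U := W₀) hxW₀
  haveI : Nonempty U := ⟨⟨x₀, hxU⟩⟩
  set ι := hU.fromSpec with hιdef
  set 𝔭 := hU.primeIdealOf ⟨x₀, hxU⟩ with h𝔭def
  have hι𝔭 : ι 𝔭 = x₀ := hU.fromSpec_primeIdealOf ⟨x₀, hxU⟩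
  have hxcl : IsClosed ({x₀} : Set X) := IsolatedClosed.isClosed_singleton_of_finite_singularLocus k X f hfin hx
  haveI h𝔭max : 𝔭.asIdeal.IsMaximal := hU.primeIdealOf_isMaximal_of_isClosed ⟨x₀, hxU⟩ hxcl
  -- points of `Spec Γ(X,U)` other than `𝔭` are regular
  have hregB : ∀ P : Spec Γ(X, U), P.asIdeal ≠ 𝔭.asIdeal → P ∈ Scheme.regularLocus (Spec Γ(X, U)) := by
    intro P hP
    rw [mem_regularLocus_iff_of_flat_of_isPreimmersion ι]
    have hPU : ι P ∈ U := by
      have : ι P ∈ Set.range ι := ⟨P, rfl⟩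
      rwa [hιdef, hU.range_fromSpec] at this
    have hPx : ι P ≠ x₀ := by
      intro h
      apply hP
      have : P = 𝔭 := ι.isOpenEmbedding.injective (h.trans hι𝔭.symm)
      rw [this]
    by_contra hnreg
    exact hUW hPU ⟨hnreg, hPx⟩
  -- `𝔭 ≠ 0`
  have h𝔭0 : 𝔭.asIdeal ≠ ⊥ := by
    intro h0
    have hbot : (⊥ : Ideal Γ(X, U)).IsMaximal := h0 ▸ h𝔭max
    obtain ⟨t, htU, htreg⟩ := (Scheme.dense_regularLocus X).inter_open_nonempty U U.2 ⟨x₀, hxU⟩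
    have htr : t ∈ Set.range ι := by rw [hιdef, hU.range_fromSpec]; exact htU
    obtain ⟨P, rfl⟩ := htr
    have hP : P.asIdeal = 𝔭.asIdeal := by
      rw [h0]
      exact (hbot.eq_of_le P.isPrime.ne_top bot_le).symm
    have hP' : P = 𝔭 := PrimeSpectrum.ext hP
    rw [hP', hι𝔭] at htreg
    exact hx htreg
  -- (3) the `k`-algebra structure of `Γ(X,U)`
  obtain ⟨gk, hgk⟩ := Spec.map_surjective (ι ≫ f)
  letI : Algebra k Γ(X, U) := gk.hom.toAlgebra
  have hιf : ι ≫ f = Spec.map (CommRingCat.ofHom (algebraMap k Γ(X, U))) := by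
    rw [← hgk]; rfl
  haveI : Algebra.FiniteType k Γ(X, U) := by
    have h1 : LocallyOfFiniteType (Spec.map gk) := by rw [hgk]; infer_instance
    rw [HasRingHomProperty.Spec_iff (P := @LocallyOfFiniteType)] at h1
    exact h1
  -- (4) the chart ring: an affine open `V ∋ y` over `U`
  have hyU : y ∈ φ ⁻¹ᵁ U := hxU
  obtain ⟨V, hV, hyV, hVU⟩ := exists_isAffineOpen_mem_and_subset (U := φ ⁻¹ᵁ U) hyU
  have hle : V ≤ φ ⁻¹ᵁ U := hVU
  set ψ := φ.appLE U V hle with hψdef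
  have hψ : ψ.hom.Etale := φ.etale_appLE hU hV hle
  letI : Algebra Γ(X, U) Γ(Y, V) := ψ.hom.toAlgebra
  haveI : Algebra.Etale Γ(X, U) Γ(Y, V) := hψ
  set 𝔔 := hV.primeIdealOf ⟨y, hyV⟩ with h𝔔def
  have hcomap : 𝔔.asIdeal.comap (algebraMap Γ(X, U) Γ(Y, V)) = 𝔭.asIdeal := by
    have h := hU.comap_primeIdealOf_appLE (f := φ) U V hV hle hyV
    exact congrArg PrimeSpectrum.asIdeal h
  -- (5) the stalk is the localization of the chart ring at `𝔔`; complete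
  letI := Y.presheaf.algebra_section_stalk (⟨y, hyV⟩ : V)
  haveI := hV.isLocalization_stalk ⟨y, hyV⟩
  let est : Localization.AtPrime 𝔔.asIdeal ≃ₐ[Γ(Y, V)] Y.presheaf.stalk y :=
    IsLocalization.algEquiv 𝔔.asIdeal.primeCompl _ _
  obtain ⟨ê, -⟩ := CompletedBaseChangeFibreCompletion.exists_ringEquiv_adicCompletion_of_ringEquiv est.symm.toRingEquiv
  -- (6) the ring-data form
  have hsing : ι ⟨𝔭.asIdeal, h𝔭max.isPrime⟩ ∉ Scheme.regularLocus X := by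
    change ι 𝔭 ∉ _
    rw [hι𝔭]; exact hx
  obtain ⟨W, hxW, huniq, Z, ρ, hρ, hZ, hiso, hdense⟩ :=
    EtaleChartTwoStepModel.hloc_of_model_charts_etale k X f ι hιf 𝔭.asIdeal h𝔭0 hsing hregB 𝔔.asIdeal hcomap a κ T 𝔳 hoff
      (e.trans ê) x hxv hfinm hmodel
  have hpt : ι ⟨𝔭.asIdeal, h𝔭max.isPrime⟩ = x₀ := hι𝔭
  rw [hpt] at hxW huniq
  exact ⟨W, hxW, huniq, Z, ρ, hρ, hZ, hiso, hdense⟩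

/-- ★★★ **RESOLUTION WHEN EVERY SINGULAR POINT HAS AN ÉTALE NEIGHBOURHOOD WHOSE COMPLETE LOCAL RING HAS A MODEL RESOLVED BY THE NAIVE
TWO-STEP RECIPE (chart facts).** [cite: Kollar2007, §2.2] -/
theorem hasResolution_of_model_charts_etale_nhd (k : Type) [Field k] (X : Scheme.{0}) [IsIntegral X]
    (f : X ⟶ Spec (.of k)) [LocallyOfFiniteType f] (hfin : (Scheme.regularLocus X)ᶜ.Finite)
    (hchart : ∀ s : X, s ∉ Scheme.regularLocus X →
      ∃ (Y : Scheme.{0}) (φ : Y ⟶ X) (_ : Etale φ) (y : Y) (a : ℕ)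
        (κ : Type) (_ : Field κ) (T : Type) (_ : CommRing T) (_ : Algebra κ T) (_ : Algebra.FiniteType κ T)
        (𝔳 : Ideal T) (_ : 𝔳.IsMaximal)
        (_ : ∀ t : Spec (.of T), t.asIdeal ≤ 𝔳 → t.asIdeal ≠ 𝔳 → t ∈ Scheme.regularLocus (Spec (.of T)))
        (_ : (AdicCompletion (maximalIdeal (Localization.AtPrime 𝔳)) (Localization.AtPrime 𝔳)) ≃+* AdicCompletion (maximalIdeal (Y.presheaf.stalk y)) (Y.presheaf.stalk y))
        (n : ℕ) (x : Fin n → T) (_ : 𝔳 ^ (a + 1) = Ideal.span (Set.range x))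
        (_ : ∀ i : Fin n, {𝔫 : PrimeSpectrum (blowupAlgebra (𝔳 ^ (a + 1)) (x i)) |
          𝔳.map (algebraMap T (blowupAlgebra (𝔳 ^ (a + 1)) (x i))) ≤ 𝔫.asIdeal ∧
            ¬ IsRegularLocalRing (Localization.AtPrime 𝔫.asIdeal)}.Finite),
        φ y = s ∧
        ∀ (i : Fin n) (𝔫 : PrimeSpectrum (blowupAlgebra (𝔳 ^ (a + 1)) (x i))),
          𝔳.map (algebraMap T (blowupAlgebra (𝔳 ^ (a + 1)) (x i))) ≤ 𝔫.asIdeal →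
          ¬ IsRegularLocalRing (Localization.AtPrime 𝔫.asIdeal) →
          Scheme.IsRegular (affineBlowup (R := Localization.AtPrime 𝔫.asIdeal)
            (maximalIdeal (Localization.AtPrime 𝔫.asIdeal)))) :
    Scheme.HasResolution X := by
  refine IsolatedGlue.hasResolution_of_finite_singularLocus_of_local k X f hfin fun s hs => ?_
  obtain ⟨Y, φ, _, y, a, κ, _, T, _, _, _, 𝔳, _, hoff, e, n, x, hxv, hfinm, hys, hmodel⟩ := hchart s hs
  subst hys
  exact hloc_of_model_charts_etale_nhd k X f hfin φ y hs a κ T 𝔳 hoff e x hxv hfinm hmodel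

end Summit.ResolutionOfSingularities.ResolutionOfSingularities.Theorems.FRationalResolution.EtaleChartTwoStepModelScheme

end
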